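import Summits.AtomisticToContinuum.BoseEinsteinCondensation.Theses.BECHusimiAmplitudeGas
import Summits.AtomisticToContinuum.BoseEinsteinCondensation.Theorems.BECHusimiAmplitudeGasLaplaceCapUnionModes
import Summits.AtomisticToContinuum.BoseEinsteinCondensation.Theorems.BECHusimiAmplitudeGasLaplaceCapUnionGaussII

/-!
# Birth skeleton (BC3) for crux `AmplitudeLDP` — stmt-AtomisticToContinuum-11991
(route `BECHusimiAmplitudeGas`, rank 3; sub-problem `BoseEinsteinCondensation`)

Planner `planner-skel-stmt-AtomisticToContinuum-11991-0`, 2026-08-17 (skeleton-register, re-audit bin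
REPAIRABLE). Published as `Cruxes/AmplitudeLDP/Lines/birth.lean`.

The crux is the integrated Laplace-principle bound for the Husimi mass of the AMPLITUDE-far region
`{c : |⟨|u_c|, φ₀⟩|² ≤ ⅞ ‖u_c‖²}` of a nonnegative periodic near-minimiser `Ψ`:
`E_w[1_far |F(|u_c|)|²] ≤ ⅛ · E_w[|⟨u_c, φ₀⟩|^{2N}] · |F(φ₀)|²`.
A Laplace principle is RATE against ENTROPY, and that is exactly how the crux is cut here:

* `stub_amplitudeRate : AmplitudeRate` — the large-deviation UPPER bound proper (the physics; the
  hard stub, size XL/open): uniformly in the box (`L = (N/ρ)^{1/3}`, all large `N`) and in the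
  profile, every amplitude-far coefficient vector `c` has
  `|F(|u_c|)|² ≤ r^N ‖u_c‖^{2N} |F(φ₀)|²` with ONE rate `r = r(v, M) < 1` chosen BEFORE `ρ₀`
  (ideal amplitude gas `Ψ = φ₀^{⊗N}`: equality structure `|F(|u_c|)|² = t^N ‖u_c‖^{2N}`,
  `t = |⟨|u_c|,φ₀⟩|²/‖u_c‖² ≤ ⅞`, so `r = ⅞` works; for the interacting amplitude gas
  `ν = Ψ/∫Ψ` the second cumulant correction has the favourable sign, `S_ν ≤ 1` at long
  wavelength, cf. the refuter's crux-attack note of 2026-08-15). This is "FlatIsOptimal with a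
  uniform rate gap" of the route's two-layer plan, in the integrated-over-nothing, pointwise-in-`c`
  form that provers must attack anyway (why it might fail: peaked profiles `û` resonating with the
  local order of the gas; no concentration inequality for the ground state's amplitude gas is in
  print — Lieb1963, arXiv:1912.04987, arXiv:2010.13187).
* `stub_gaussianSphereMoment : GaussianSphereMoment` — the ENTROPY of the Gaussian sphere, an exact
  Gaussian computation (size M, provable now): `∫ e^{-|c|²} |c|^{2N} dc ≤ C(N+d-1, N) ∫ e^{-|c|²} |c_{i₀}|^{2N} dc`
  on `ℂ^d` (the left side is `π^d Γ(N+d)/Γ(d)`, the integral on the right is `π^d N!`, and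
  `C(N+d-1,N)·N! = Γ(N+d)/Γ(d)`: equality holds; `≤` is all the line uses). Leans on the landed radial
  moment identity `LaplaceCapUnion.lintegral_sum_norm_sq_mul_gauss`, `bargmann`-file Gaussian
  moments, `Real.Gamma_nat_eq_factorial`, polar/Fubini on `ι → ℂ`.
* `stub_sphereEntropyDecay : SphereEntropyDecay` — rate beats entropy at low density (size M,
  provable now; pure real asymptotics, no quantum object): with `d = (2R+1)³`,
  `R = ⌊M L √(ρa)⌋`, `L = (N/ρ)^{1/3}` one has `d/N → θ(ρ) = 8 M³ √(ρ a³)` and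
  `log C(N+d-1, N) ≤ N h(d/N)`, `h(θ) = (1+θ) log(1+θ) - θ log θ → 0` as `ρ → 0`, so for every
  `r < 1`: `8 r^N C(N+d-1, N) ≤ 1` for `ρ < ρ₀(a, M, r)` and all large `N` (`a = 0`: `d = 1`).
  Leans on `Nat.choose_le_pow_div` (`C(n,k) ≤ n^k/k!`, with `k = d-1`: `log C(N+d-1,N) ≤
  (d-1)(log((N+d-1)/(d-1)) + 1) = N·O(θ log(1/θ))`), `Nat.floor_le`, `Real.rpow_natCast`/`rpow_mul`
  for `L³ = N/ρ`, and elementary real bounds; no quantum object enters.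

Composition `AmplitudeLDP_of : AmplitudeRate → GaussianSphereMoment → SphereEntropyDecay → AmplitudeLDP`
(hypotheses spelled `__Registered.stub_X`, `rfl`-aliases keyed by the stub names, for the native audit)
is proved below WITHOUT `sorry` (monotonicity of `∫⁻`, the landed zero-mode overlap identity
`LaplaceCapUnion.ov_sum_modes : ⟨u_c, φ₀⟩ = conj c_{i₀}`, and `ℝ≥0∞` bookkeeping); it concludes the
route decl `Summit.AtomisticToContinuum.BoseEinsteinCondensation.Theses.BECHusimiAmplitudeGas.AmplitudeLDP`
BY NAME. Sorries live only in the three `stub_*` theorems.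

Disproof used: none relevant (no `Cruxes/AmplitudeLDP/Disproof.lean`, no landed Negative lemma for
this crux on 2026-08-17; `ledger crux ls` showed no workfiles). Degenerate audit: `v ≡ 0`/`a = 0`/
`a = ⊤` give `R = 0`, `d = 1`, `u_c = c·φ₀`, `|u_c| = |c| φ₀`, `t = 1 > ⅞`: the far region is empty,
`AmplitudeRate` is vacuous there and `SphereEntropyDecay` reads `8 r^N ≤ 1` eventually — all true.

BC3 audit (planner folder `bc/`, 2026-08-17, farm `lean check --json`): this file rc 0, errors [],
sorries 3 = the three `stub_*` (lines of the three `declaration uses sorry` warnings are exactly the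
stub theorems), `#print axioms AmplitudeLDP_of` = [propext, Classical.choice, Quot.sound] (no
`sorryAx`). Probes (files `bc/<Stub>_probe.lean`, stub defs only, 10 examples each): for every stub
`S ∈ {AmplitudeRate, GaussianSphereMoment, SphereEntropyDecay}` both `S → AmplitudeLDP` and
`S → _root_.BoseEinsteinCondensation` by `first | exact? | simpa [S] | (unfold S; simpa) | aesop`
FAIL (combined form and each alternative separately: `exact?` "could not close the goal", `simpa`
"assumption failed", `aesop` "failed to prove the goal after exhaustive search"; the combined
`AmplitudeRate → AmplitudeLDP` probe exhausts 400000 heartbeats) — 30/30 probes fail: no stub is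
cheaply the crux or the summit.
-/

noncomputable section

namespace Summit.AtomisticToContinuum.BoseEinsteinCondensation.Cruxes.AmplitudeLDP.Birth

open MeasureTheory Filter
open scoped ENNReal NNReal ComplexConjugate BigOperators Classical
open Literature.MathematicalPhysics.QuantumManyBody.BoseGas
open Summit.AtomisticToContinuum.BoseEinsteinCondensation.Theses.BECHusimiAmplitudeGas
open Summit.AtomisticToContinuum.BoseEinsteinCondensation.Theorems.LaplaceCapUnion

/-! ## Stub statements -/

/-- **Stub A — amplitude-gas large-deviation rate (the LDP proper).** For admissible `v` and cutoff
multiplier `M ≥ 1` there is ONE rate `r ∈ (0,1)` (depending on `v, M` only) and `ρ₀ > 0` such that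
for `0 < ρ < ρ₀`, all large `N`, some `δ > 0` and every NONNEGATIVE periodic `δ`-near-minimiser `Ψ`
on the torus of side `L = (N/ρ)^{1/3}`: for every coefficient vector `c` of the `(2R+1)³` slow modes
whose modulus profile is amplitude-far, `|⟨|u_c|, φ₀⟩|² ≤ ⅞ ∑ᵢ|cᵢ|²`, the positive functional obeys
`|F(|u_c|)|² ≤ r^N (∑ᵢ|cᵢ|²)^N |F(φ₀)|²` — i.e. `E_ν[∏ⱼ |û(xⱼ)| L^{3/2}] ≤ r^{N/2}` for Lieb's
amplitude gas `ν = Ψ/∫Ψ` and every amplitude-far unit profile `û`, uniformly in `L`. -/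
def AmplitudeRate : Prop :=
  ∀ v : ℝ → ℝ≥0∞, IsRepulsiveFiniteRange v → ∀ M : ℝ, 1 ≤ M →
    ∃ r : ℝ, 0 < r ∧ r < 1 ∧ ∃ ρ₀ : ℝ, 0 < ρ₀ ∧ ∀ ρ : ℝ, 0 < ρ → ρ < ρ₀ →
      ∀ᶠ N : ℕ in Filter.atTop, ∃ δ : ℝ≥0∞, 0 < δ ∧
        ∀ Ψ : PeriodicTrialState N (sideLength ρ N),
          periodicEnergy v Ψ ≤ periodicGroundStateEnergy v N (sideLength ρ N) + δ →
          (∀ X, Ψ.ψ X = ((‖Ψ.ψ X‖ : ℝ) : ℂ)) →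
          let L : ℝ := sideLength ρ N
          let R : ℕ := ⌊M * L * Real.sqrt (ρ * (scatteringLength v).toReal)⌋₊
          let e : (Fin 3 → Fin (2 * R + 1)) → Space → ℂ := fun i x =>
            cellWave L (fun k => ((i k : ℕ) : ℤ) - (R : ℤ)) x / (Real.sqrt (L ^ 3) : ℂ)
          let u : ((Fin 3 → Fin (2 * R + 1)) → ℂ) → Space → ℂ := fun c x => ∑ i, c i * e i x
          let F : (Space → ℂ) → ℂ := fun g => ∫ X in cellN N L, (∏ j, conj (g (X j))) * Ψ.ψ X
          let ov : (Space → ℂ) → ℂ := fun g => ∫ x in cell L, conj (g x) * constantMode L x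
          ∀ c : (Fin 3 → Fin (2 * R + 1)) → ℂ,
            ‖ov (fun x => ((‖u c x‖ : ℝ) : ℂ))‖ ^ 2 ≤ (7 / 8) * ∑ i, ‖c i‖ ^ 2 →
            ((‖F (fun x => ((‖u c x‖ : ℝ) : ℂ))‖₊ : ℝ≥0∞) ^ 2) ≤
              ENNReal.ofReal (r ^ N) * ENNReal.ofReal ((∑ i, ‖c i‖ ^ 2) ^ N) *
                ((‖F (constantMode L)‖₊ : ℝ≥0∞) ^ 2)

/-- **Stub B — entropy of the Gaussian sphere (exact Gaussian moments).** On `ℂ^ι` with the weight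
`e^{-∑|cᵢ|²}`: `∫ e^{-|c|²} (∑ᵢ|cᵢ|²)^N ≤ C(N + |ι| - 1, N) · ∫ e^{-|c|²} |c_{i₀}|^{2N}`
(in fact equality: `π^{|ι|} Γ(N+|ι|)/Γ(|ι|)` versus `π^{|ι|} N!`). The binomial is the number of
degree-`N` monomials in `|ι|` variables — the "sphere entropy" `e^{N h(|ι|/N)}` of the Laplace principle. -/
def GaussianSphereMoment : Prop :=
  ∀ {ι : Type} [Fintype ι] (i₀ : ι) (N : ℕ),
    (∫⁻ c : ι → ℂ, ENNReal.ofReal (Real.exp (-(∑ i, ‖c i‖ ^ 2))) *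
        ENNReal.ofReal ((∑ i, ‖c i‖ ^ 2) ^ N)) ≤
      (Nat.choose (N + Fintype.card ι - 1) N : ℝ≥0∞) *
        ∫⁻ c : ι → ℂ, ENNReal.ofReal (Real.exp (-(∑ i, ‖c i‖ ^ 2))) * ((‖c i₀‖₊ : ℝ≥0∞) ^ (2 * N))

/-- **Stub C — the rate beats the sphere entropy at low density (real asymptotics).** For the cube of
`d = (2R+1)³` modes, `R = ⌊M L √(ρ a)⌋`, `L = (N/ρ)^{1/3}`: `d/N → 8M³√(ρa³)` and
`C(N+d-1, N) ≤ e^{N h(d/N)}` with `h(θ) = (1+θ)log(1+θ) - θ log θ → 0`, hence for every rate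
`r < 1` there is `ρ₀(a, M, r) > 0` with `8 r^N C(N+d-1, N) ≤ 1` for `0 < ρ < ρ₀` and all large `N`
(any real `a, M`; `a ≤ 0` or `M ≤ 0` gives `R = 0`, `d = 1`). Used with `a = (scatteringLength v).toReal`. -/
def SphereEntropyDecay : Prop :=
  ∀ a M r : ℝ, 0 < r → r < 1 → ∃ ρ₀ : ℝ, 0 < ρ₀ ∧ ∀ ρ : ℝ, 0 < ρ → ρ < ρ₀ →
    ∀ᶠ N : ℕ in Filter.atTop,
      8 * (r ^ N * (Nat.choose (N + (2 * ⌊M * sideLength ρ N * Real.sqrt (ρ * a)⌋₊ + 1) ^ 3 - 1) N : ℝ))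
        ≤ 1

/-! ## Registered stubs -/

/-- stub A: the amplitude-gas LDP rate bound (hardest stub; the open core of the crux). -/
theorem stub_amplitudeRate : AmplitudeRate := by
  sorry

/-- stub B: exact Gaussian sphere moments (provable now). -/
theorem stub_gaussianSphereMoment : GaussianSphereMoment := by
  sorry

/-- stub C: sphere entropy `h(θ(ρ)) → 0` beats any fixed rate (provable now). -/
theorem stub_sphereEntropyDecay : SphereEntropyDecay := by
  sorry

/-! ## Name-keyed aliases of the three stub statements — the hypotheses of `AmplitudeLDP_of`

The native skeleton audit (`#h21_check_skeleton`) admits a hypothesis of the skeleton theorem only if its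
head constant is a registered obligation or is NAMED like a declared stub; `__Registered.stub_X` is the
statement of `stub_X` under that name (device of `CriticalPhenomena/SAWScalingLimit/Cruxes/AxiomsOfLimit/
Lines/birth.lean` and `RiemannHypothesis/…/Lines/pencil_bracket_count.lean`; the `__` namespace is an
implementation detail, and the gate-reserved `@[stub]` attribute is not written by a planner). Each alias
is `rfl`-equal to its statement. -/
namespace __Registered

/-- Alias of `AmplitudeRate` keyed by the registered stub name. -/
abbrev stub_amplitudeRate : Prop := AmplitudeRate
/-- Alias of `GaussianSphereMoment` keyed by the registered stub name. -/
abbrev stub_gaussianSphereMoment : Prop := GaussianSphereMoment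
/-- Alias of `SphereEntropyDecay` keyed by the registered stub name. -/
abbrev stub_sphereEntropyDecay : Prop := SphereEntropyDecay

end __Registered

/-! ## Composition: the crux BY NAME from the three stub statements (no `sorry` below) -/

/-- **AmplitudeLDP_of** — rate (A) × entropy (B, C) ⟹ the integrated Laplace bound `AmplitudeLDP`:
pointwise `w·1_far·|F(|u_c|)|² ≤ w·(∑|cᵢ|²)^N · r^N |F(φ₀)|²` (A; zero off the far region),
integrate (`lintegral_mono`, `lintegral_mul_const'`), bound the radial moment by the binomial times the
zero-mode moment (B), identify `‖⟨u_c,φ₀⟩‖ = ‖c_{i₀}‖` (`ov_sum_modes`), and absorb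
`8 r^N C(N+d-1,N) ≤ 1` (C) into the factor `⅛`. Hypotheses = the three stub statements under their
registered names (`__Registered.stub_X` is `X` by `rfl`); conclusion = the route decl, by name. -/
theorem AmplitudeLDP_of (hA : __Registered.stub_amplitudeRate)
    (hG : __Registered.stub_gaussianSphereMoment) (hS : __Registered.stub_sphereEntropyDecay) :
    Summit.AtomisticToContinuum.BoseEinsteinCondensation.Theses.BECHusimiAmplitudeGas.AmplitudeLDP := by
  intro v hv M hM
  obtain ⟨r, hr0, hr1, ρ₁, hρ₁, H1⟩ := hA v hv M hM
  obtain ⟨ρ₂, hρ₂, H2⟩ := hS (scatteringLength v).toReal M r hr0 hr1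
  refine ⟨min ρ₁ ρ₂, lt_min hρ₁ hρ₂, fun ρ hρ hρlt => ?_⟩
  filter_upwards [H1 ρ hρ (lt_of_lt_of_le hρlt (min_le_left _ _)),
    H2 ρ hρ (lt_of_lt_of_le hρlt (min_le_right _ _)), Filter.eventually_ge_atTop 1]
    with N hN1 hN2 hNpos
  obtain ⟨δ, hδ, H⟩ := hN1
  refine ⟨δ, hδ, fun Ψ hΨE hΨpos => ?_⟩
  intro L R e u F ov w farAmp
  -- (A) pointwise rate bound for this state
  have HP : ∀ c : (Fin 3 → Fin (2 * R + 1)) → ℂ, farAmp c →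
      ((‖F (fun x => ((‖u c x‖ : ℝ) : ℂ))‖₊ : ℝ≥0∞) ^ 2) ≤
        ENNReal.ofReal (r ^ N) * ENNReal.ofReal ((∑ i, ‖c i‖ ^ 2) ^ N) *
          ((‖F (constantMode L)‖₊ : ℝ≥0∞) ^ 2) := H Ψ hΨE hΨpos
  -- (C) entropy decay at this `N`
  have HS : 8 * (r ^ N * (Nat.choose (N + (2 * R + 1) ^ 3 - 1) N : ℝ)) ≤ 1 := hN2
  -- abbreviations and the zero-mode overlap identity
  set K : ℝ≥0∞ := ((‖F (constantMode L)‖₊ : ℝ≥0∞) ^ 2) with hK_def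
  set i₀ : Fin 3 → Fin (2 * R + 1) := fun _ => ⟨R, by omega⟩ with hi₀_def
  have hL : 0 < L := Real.rpow_pos_of_pos (div_pos (by exact_mod_cast hNpos) hρ) _
  have hov : ∀ c : (Fin 3 → Fin (2 * R + 1)) → ℂ, ‖ov (u c)‖ = ‖c i₀‖ := fun c => by
    show ‖∫ x in cell L, conj (∑ i, c i * (cellWave L (fun k => ((i k : ℕ) : ℤ) - (R : ℤ)) x /
      (Real.sqrt (L ^ 3) : ℂ))) * constantMode L x‖ = _
    rw [ov_sum_modes hL c, Complex.norm_conj]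
  have hovnn : ∀ c : (Fin 3 → Fin (2 * R + 1)) → ℂ, (‖ov (u c)‖₊ : ℝ≥0∞) = ‖c i₀‖₊ := fun c => by
    rw [← enorm_eq_nnnorm, ← enorm_eq_nnnorm, ← ofReal_norm, ← ofReal_norm, hov c]
  have hX : ∫⁻ c : (Fin 3 → Fin (2 * R + 1)) → ℂ, w c * ((‖ov (u c)‖₊ : ℝ≥0∞) ^ (2 * N)) =
      ∫⁻ c : (Fin 3 → Fin (2 * R + 1)) → ℂ, w c * ((‖c i₀‖₊ : ℝ≥0∞) ^ (2 * N)) :=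
    lintegral_congr fun c => by rw [hovnn c]
  -- step 1: pointwise domination of the integrand
  have step1 : ∀ c : (Fin 3 → Fin (2 * R + 1)) → ℂ,
      w c * (if farAmp c then 1 else 0) * ((‖F (fun x => ((‖u c x‖ : ℝ) : ℂ))‖₊ : ℝ≥0∞) ^ 2) ≤
        (w c * ENNReal.ofReal ((∑ i, ‖c i‖ ^ 2) ^ N)) * (ENNReal.ofReal (r ^ N) * K) := by
    intro c
    by_cases hc : farAmp c
    · rw [if_pos hc, mul_one]
      calc w c * ((‖F (fun x => ((‖u c x‖ : ℝ) : ℂ))‖₊ : ℝ≥0∞) ^ 2)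
          ≤ w c * (ENNReal.ofReal (r ^ N) * ENNReal.ofReal ((∑ i, ‖c i‖ ^ 2) ^ N) * K) :=
            mul_le_mul' le_rfl (HP c hc)
        _ = (w c * ENNReal.ofReal ((∑ i, ‖c i‖ ^ 2) ^ N)) * (ENNReal.ofReal (r ^ N) * K) := by
            ring
    · rw [if_neg hc, mul_zero, zero_mul]
      exact bot_le
  -- step 2: integrate and pull out the constant
  have hconst : ENNReal.ofReal (r ^ N) * K ≠ ⊤ :=
    ENNReal.mul_ne_top ENNReal.ofReal_ne_top (ENNReal.pow_ne_top ENNReal.coe_ne_top)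
  have step2 : (∫⁻ c : (Fin 3 → Fin (2 * R + 1)) → ℂ,
      w c * (if farAmp c then 1 else 0) * ((‖F (fun x => ((‖u c x‖ : ℝ) : ℂ))‖₊ : ℝ≥0∞) ^ 2)) ≤
      (∫⁻ c : (Fin 3 → Fin (2 * R + 1)) → ℂ, w c * ENNReal.ofReal ((∑ i, ‖c i‖ ^ 2) ^ N)) *
        (ENNReal.ofReal (r ^ N) * K) := by
    calc (∫⁻ c : (Fin 3 → Fin (2 * R + 1)) → ℂ,
          w c * (if farAmp c then 1 else 0) * ((‖F (fun x => ((‖u c x‖ : ℝ) : ℂ))‖₊ : ℝ≥0∞) ^ 2))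
        ≤ ∫⁻ c : (Fin 3 → Fin (2 * R + 1)) → ℂ,
            (w c * ENNReal.ofReal ((∑ i, ‖c i‖ ^ 2) ^ N)) * (ENNReal.ofReal (r ^ N) * K) :=
          lintegral_mono step1
      _ = (∫⁻ c : (Fin 3 → Fin (2 * R + 1)) → ℂ, w c * ENNReal.ofReal ((∑ i, ‖c i‖ ^ 2) ^ N)) *
            (ENNReal.ofReal (r ^ N) * K) := lintegral_mul_const' _ _ hconst
  -- step 3: (B) the Gaussian sphere moment against the zero-mode moment
  have hcard : Fintype.card (Fin 3 → Fin (2 * R + 1)) = (2 * R + 1) ^ 3 := by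
    simp
  have step3 : (∫⁻ c : (Fin 3 → Fin (2 * R + 1)) → ℂ, w c * ENNReal.ofReal ((∑ i, ‖c i‖ ^ 2) ^ N)) ≤
      (Nat.choose (N + (2 * R + 1) ^ 3 - 1) N : ℝ≥0∞) *
        ∫⁻ c : (Fin 3 → Fin (2 * R + 1)) → ℂ, w c * ((‖c i₀‖₊ : ℝ≥0∞) ^ (2 * N)) := by
    have h := hG i₀ N
    rw [hcard] at h
    exact h
  -- step 4: (C) in `ℝ≥0∞`: `r^N · C(N+d-1,N) ≤ ⅛`
  have step4 : ENNReal.ofReal (r ^ N) * (Nat.choose (N + (2 * R + 1) ^ 3 - 1) N : ℝ≥0∞) ≤ 1 / 8 := by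
    have hle : r ^ N * (Nat.choose (N + (2 * R + 1) ^ 3 - 1) N : ℝ) ≤ 1 / 8 := by
      linarith
    rw [← ENNReal.ofReal_natCast, ← ENNReal.ofReal_mul (pow_nonneg hr0.le N),
      one_div_eight_eq_ofReal]
    exact ENNReal.ofReal_le_ofReal hle
  -- assemble
  calc (∫⁻ c : (Fin 3 → Fin (2 * R + 1)) → ℂ,
        w c * (if farAmp c then 1 else 0) * ((‖F (fun x => ((‖u c x‖ : ℝ) : ℂ))‖₊ : ℝ≥0∞) ^ 2))
      ≤ (∫⁻ c : (Fin 3 → Fin (2 * R + 1)) → ℂ, w c * ENNReal.ofReal ((∑ i, ‖c i‖ ^ 2) ^ N)) *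
          (ENNReal.ofReal (r ^ N) * K) := step2
    _ ≤ ((Nat.choose (N + (2 * R + 1) ^ 3 - 1) N : ℝ≥0∞) *
          ∫⁻ c : (Fin 3 → Fin (2 * R + 1)) → ℂ, w c * ((‖c i₀‖₊ : ℝ≥0∞) ^ (2 * N))) *
          (ENNReal.ofReal (r ^ N) * K) := mul_le_mul' step3 le_rfl
    _ = (ENNReal.ofReal (r ^ N) * (Nat.choose (N + (2 * R + 1) ^ 3 - 1) N : ℝ≥0∞)) *
          ((∫⁻ c : (Fin 3 → Fin (2 * R + 1)) → ℂ, w c * ((‖c i₀‖₊ : ℝ≥0∞) ^ (2 * N))) * K) := by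
        ring
    _ ≤ (1 / 8) *
          ((∫⁻ c : (Fin 3 → Fin (2 * R + 1)) → ℂ, w c * ((‖c i₀‖₊ : ℝ≥0∞) ^ (2 * N))) * K) :=
        mul_le_mul' step4 le_rfl
    _ = (1 / 8) * (∫⁻ c : (Fin 3 → Fin (2 * R + 1)) → ℂ, w c * ((‖ov (u c)‖₊ : ℝ≥0∞) ^ (2 * N))) *
          K := by
        rw [hX, mul_assoc]

/-- Wiring check (an `example`, so that `AmplitudeLDP_of` stays the only theorem concluding the crux):
the registered stubs feed the skeleton theorem as stated — this term becomes the crux proof when the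
three `sorry`s above are discharged (it carries `sorryAx` exactly through the three `stub_*`). -/
example : Summit.AtomisticToContinuum.BoseEinsteinCondensation.Theses.BECHusimiAmplitudeGas.AmplitudeLDP :=
  AmplitudeLDP_of stub_amplitudeRate stub_gaussianSphereMoment stub_sphereEntropyDecay

/-- The plain-arrow form `<stub sigs> → AmplitudeLDP` of the skeleton theorem (same proof term). -/
example : AmplitudeRate → GaussianSphereMoment → SphereEntropyDecay →
    Summit.AtomisticToContinuum.BoseEinsteinCondensation.Theses.BECHusimiAmplitudeGas.AmplitudeLDP :=
  AmplitudeLDP_of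

end Summit.AtomisticToContinuum.BoseEinsteinCondensation.Cruxes.AmplitudeLDP.Birth

end
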